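import Summits.AtomisticToContinuum.FouriersLaw.Theorems.HiddenChargeMazurThomsonBoundLiouville
import Summits.AtomisticToContinuum.FouriersLaw.Theorems.HiddenChargeMazurThomsonBoundCutoff

/-!
# Current identities in `L²(e^{-H/T})` from the Poisson equation `L F = -J` (Thomson bound, part D)

Helper file (`--supports stmt-AtomisticToContinuum-13512`, decl `HiddenChargeMazur.ThomsonBound`).
For the pinned anharmonic chain `pinnedChain ω₂ lam β γ` (`ω₂ > 0`, `lam, β ≥ 0`, `γ > 0`), `T > 0`,
`ρ = e^{-H/T}`, the total current `J = ∑_i j_i` and the growth class of the item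
(`|u|, |∂u| ≤ C e^{θH}`, `θ < 1/(2T)`):

* `integral_current_mul_eq`: if `F ∈ C²` (class) solves `L_{T,T} F = -J` pointwise, then for every
  `u ∈ C¹` (class) `∫ J u ρ = ∫ F (A u) ρ + γ T ∑_b ∫ ∂_{p_b}F ∂_{p_b}u ρ` (parts B and C applied
  to `K = γ⁻¹(-J - A F)`);
* `integral_current_mul_self`: `∫ J F ρ = γ T ∑_b ∫ (∂_{p_b}F)² ρ` (the dissipation identity);
* `integral_mul_adjointP`: `∫ F (-∂_{p_b} w + (p_b/T) w) ρ = ∫ (∂_{p_b}F) w ρ` (the `L²(ρ)`-adjoint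
  of `∂_{p_b}` is `∂*_{p_b} = -∂_{p_b} + p_b/T`, the dressing operator of the item);
* `bathSum_cauchySchwarz`: `(∑_b ∫ a_b v_b ρ)² ≤ (∑_b ∫ a_b² ρ)(∑_b ∫ v_b² ρ)` for the two-bath sums
  `∑_i ([i = 0] · + [i = N-1] ·)` (discriminant of a nonnegative quadratic form).
[Bonetto–Lebowitz–Rey-Bellet 2000, §4.1; Kundu–Dhar–Narayan 2009, p. 3]
-/

noncomputable section

open MeasureTheory Filter Topology

namespace Summit.AtomisticToContinuum.FouriersLaw.Theorems.ThomsonBound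

open Literature.MathematicalPhysics.KineticTheory.HeatConduction

variable {N : ℕ}

section Pinned

variable {ω₂ lam β : ℝ}

/-! ### The current is in the weighted class -/

/-- `|J| = |∑_i j_i| ≤ N² (3+β)/2 (1+H)²`. [folklore] -/
theorem abs_current_le (hω : 0 < ω₂) (hl : 0 ≤ lam) (hβ : 0 ≤ β) (γ : ℝ) (N : ℕ)
    (x : PhaseSpace N) :
    |∑ i, (pinnedChain ω₂ lam β γ).bondCurrent N i x| ≤
      (N * (N * ((3 + β) / 2))) * (1 + (pinnedChain ω₂ lam β γ).hamiltonian N x) ^ 2 := by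
  calc |∑ i, (pinnedChain ω₂ lam β γ).bondCurrent N i x|
      ≤ ∑ i, |(pinnedChain ω₂ lam β γ).bondCurrent N i x| := Finset.abs_sum_le_sum_abs _ _
    _ ≤ ∑ _i : Fin N, N * ((3 + β) / 2 * (1 + (pinnedChain ω₂ lam β γ).hamiltonian N x) ^ 2) :=
        Finset.sum_le_sum fun i _ => pinnedChain_abs_bondCurrent_le hω.le hl hβ γ N i x
    _ = (N * (N * ((3 + β) / 2))) * (1 + (pinnedChain ω₂ lam β γ).hamiltonian N x) ^ 2 := by
        simp only [Finset.sum_const, Finset.card_univ, Fintype.card_fin, nsmul_eq_mul]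
        ring

/-- `J u e^{-H/T} ∈ L¹` for a continuous `u = O(e^{θH})`, `θ < 1/(2T)`. [folklore] -/
theorem integrable_current_mul (hω : 0 < ω₂) (hl : 0 ≤ lam) (hβ : 0 ≤ β) (γ : ℝ) (N : ℕ)
    {T θ : ℝ} (hT : 0 < T) (hθ : θ < 1 / (2 * T)) {u : PhaseSpace N → ℝ} (hu : Continuous u)
    {C : ℝ} (hule : ∀ x, |u x| ≤ C * Real.exp (θ * (pinnedChain ω₂ lam β γ).hamiltonian N x)) :
    Integrable fun x => (∑ i, (pinnedChain ω₂ lam β γ).bondCurrent N i x) * u x *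
      (pinnedChain ω₂ lam β γ).gibbsDensity N T x := by
  have hθ1 : θ < 1 / T := hθ.trans_le (one_div_le_one_div_of_le hT (by linarith))
  exact integrable_mul_gibbsDensity_of_le_exp hω hl hβ γ N hT hθ1 2
    ((continuous_finsetSum _ fun i _ => pinnedChain_continuous_bondCurrent ω₂ lam β γ N i).mul hu)
    fun x => abs_weight_mul_le (abs_current_le hω hl hβ γ N x) (hule x)

/-! ### `∫ J u ρ = ∫ F (A u) ρ + γ T ∑_b ∫ ∂_b F ∂_b u ρ` from the Poisson equation `L F = -J` -/

/-- **The current against a class member, via the Poisson equation.** For `F ∈ C²` and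
`u ∈ C¹` in the growth class (`θ < 1/(2T)`) with `L_{T,T} F = -J` pointwise (`L = A + γ K`,
`A` the Liouville operator, `K` the two-bath Ornstein–Uhlenbeck part):
`∫ J u ρ = ∫ F (A u) ρ + γ T ∑_{b} ∫ ∂_{p_b}F ∂_{p_b}u ρ` (antisymmetry of `A`, the bath identity
of part C applied to `K = γ⁻¹(-J - A F)`, whose product with `u ρ` is integrable).
[Bonetto–Lebowitz–Rey-Bellet 2000, §4.1; Kundu–Dhar–Narayan 2009, p. 3] [folklore] -/
theorem integral_current_mul_eq (hω : 0 < ω₂) (hl : 0 ≤ lam) (hβ : 0 ≤ β) {γ : ℝ} (hγ : 0 < γ)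
    (N : ℕ) {T θ : ℝ} (hT : 0 < T) (hθ : θ < 1 / (2 * T)) {F u : PhaseSpace N → ℝ}
    (hF : ContDiff ℝ 2 F) (hu : ContDiff ℝ 1 u) {CF Cu : ℝ}
    (hFle : ∀ x, |F x| ≤ CF * Real.exp (θ * (pinnedChain ω₂ lam β γ).hamiltonian N x))
    (hFq : ∀ x i, |partialQ i F x| ≤ CF * Real.exp (θ * (pinnedChain ω₂ lam β γ).hamiltonian N x))
    (hFp : ∀ x i, |partialP i F x| ≤ CF * Real.exp (θ * (pinnedChain ω₂ lam β γ).hamiltonian N x))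
    (hule : ∀ x, |u x| ≤ Cu * Real.exp (θ * (pinnedChain ω₂ lam β γ).hamiltonian N x))
    (huq : ∀ x i, |partialQ i u x| ≤ Cu * Real.exp (θ * (pinnedChain ω₂ lam β γ).hamiltonian N x))
    (hup : ∀ x i, |partialP i u x| ≤ Cu * Real.exp (θ * (pinnedChain ω₂ lam β γ).hamiltonian N x))
    (hLF : ∀ x, (pinnedChain ω₂ lam β γ).generator N T T F x =
      -(∑ i, (pinnedChain ω₂ lam β γ).bondCurrent N i x)) :
    ∫ x, (∑ i, (pinnedChain ω₂ lam β γ).bondCurrent N i x) * u x *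
        (pinnedChain ω₂ lam β γ).gibbsDensity N T x =
      (∫ x, F x * (∑ i, (x.2 i * partialQ i u x -
        partialQ i ((pinnedChain ω₂ lam β γ).hamiltonian N) x * partialP i u x)) *
        (pinnedChain ω₂ lam β γ).gibbsDensity N T x) +
      γ * T * ∑ i : Fin N,
        ((if i.val = 0 then ∫ x, partialP i F x * partialP i u x *
            (pinnedChain ω₂ lam β γ).gibbsDensity N T x else 0) +
          (if i.val = N - 1 then ∫ x, partialP i F x * partialP i u x *
            (pinnedChain ω₂ lam β γ).gibbsDensity N T x else 0)) := by
  -- `L F = A F + γ K` pointwise (definition of the generator), hence `K = -γ⁻¹ (J + A F)`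
  have hK : ∀ x, (∑ i : Fin N,
      ((if i.val = 0 then T * partialP i (partialP i F) x - x.2 i * partialP i F x else 0) +
        (if i.val = N - 1 then T * partialP i (partialP i F) x - x.2 i * partialP i F x else 0))) =
      -γ⁻¹ * ((∑ i, (pinnedChain ω₂ lam β γ).bondCurrent N i x) +
        ∑ i, (x.2 i * partialQ i F x -
          partialQ i ((pinnedChain ω₂ lam β γ).hamiltonian N) x * partialP i F x)) := by
    intro x
    have h : (∑ i, (x.2 i * partialQ i F x -
        partialQ i ((pinnedChain ω₂ lam β γ).hamiltonian N) x * partialP i F x)) +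
        γ * (∑ i : Fin N, ((if i.val = 0 then T * partialP i (partialP i F) x -
          x.2 i * partialP i F x else 0) + (if i.val = N - 1 then T * partialP i (partialP i F) x -
          x.2 i * partialP i F x else 0))) = -(∑ i, (pinnedChain ω₂ lam β γ).bondCurrent N i x) :=
      hLF x
    field_simp
    linarith
  have IJ := integrable_current_mul hω hl hβ γ N hT hθ hu.continuous hule
  have IAF : Integrable fun x => (∑ i, (x.2 i * partialQ i F x -
      partialQ i ((pinnedChain ω₂ lam β γ).hamiltonian N) x * partialP i F x)) * u x *
      (pinnedChain ω₂ lam β γ).gibbsDensity N T x := by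
    refine (integrable_finsetSum Finset.univ fun i _ => integrable_liouvilleSite_mul hω hl hβ γ N
      hT hθ (hF.of_le one_le_two) hu.continuous hFq hFp hule i).congr
      (Filter.Eventually.of_forall fun x => ?_)
    simp only [Finset.sum_mul]
  have IK : Integrable fun x => (∑ i : Fin N,
      ((if i.val = 0 then T * partialP i (partialP i F) x - x.2 i * partialP i F x else 0) +
        (if i.val = N - 1 then T * partialP i (partialP i F) x - x.2 i * partialP i F x else 0))) *
      u x * (pinnedChain ω₂ lam β γ).gibbsDensity N T x := by
    refine ((IJ.add IAF).const_mul (-γ⁻¹)).congr (Filter.Eventually.of_forall fun x => ?_)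
    simp only [Pi.add_apply]
    rw [hK x]
    ring
  have hC := integral_bathSum_mul_eq hω hl hβ γ N hT hθ hF hu hFp hule hup IK
  have hB := integral_liouville_mul_eq_neg hω hl hβ γ N hT hθ (hF.of_le one_le_two) hu hFle hFq hFp
    hule huq hup
  have hlin : ∫ x, (∑ i : Fin N,
      ((if i.val = 0 then T * partialP i (partialP i F) x - x.2 i * partialP i F x else 0) +
        (if i.val = N - 1 then T * partialP i (partialP i F) x - x.2 i * partialP i F x else 0))) *
      u x * (pinnedChain ω₂ lam β γ).gibbsDensity N T x =
      -γ⁻¹ * ((∫ x, (∑ i, (pinnedChain ω₂ lam β γ).bondCurrent N i x) * u x *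
        (pinnedChain ω₂ lam β γ).gibbsDensity N T x) +
        ∫ x, (∑ i, (x.2 i * partialQ i F x -
          partialQ i ((pinnedChain ω₂ lam β γ).hamiltonian N) x * partialP i F x)) * u x *
          (pinnedChain ω₂ lam β γ).gibbsDensity N T x) := by
    rw [← integral_add IJ IAF, ← integral_const_mul]
    refine integral_congr_ae (Filter.Eventually.of_forall fun x => ?_)
    simp only
    rw [hK x]
    ring
  rw [hC, hB] at hlin
  have hγne : γ ≠ 0 := hγ.ne'
  have key : γ * (-T * ∑ i : Fin N, ((if i.val = 0 then ∫ x, partialP i F x * partialP i u x *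
      (pinnedChain ω₂ lam β γ).gibbsDensity N T x else 0) + (if i.val = N - 1 then
      ∫ x, partialP i F x * partialP i u x * (pinnedChain ω₂ lam β γ).gibbsDensity N T x else 0))) =
      -((∫ x, (∑ i, (pinnedChain ω₂ lam β γ).bondCurrent N i x) * u x *
        (pinnedChain ω₂ lam β γ).gibbsDensity N T x) +
        -∫ x, F x * (∑ i, (x.2 i * partialQ i u x -
          partialQ i ((pinnedChain ω₂ lam β γ).hamiltonian N) x * partialP i u x)) *
          (pinnedChain ω₂ lam β γ).gibbsDensity N T x) := by
    rw [hlin, ← mul_assoc, mul_neg, mul_inv_cancel₀ hγne]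
    ring
  linarith

/-! ### The `L²(ρ)`-adjoint of `∂_{p_b}`: `∫ F (-∂_b w + p_b w/T) ρ = ∫ (∂_b F) w ρ` -/

/-- **Adjoint of `∂_{p_b}` against `e^{-H/T}`.** For `C¹` class members `F, w`
(`|F|, |∂_{p_b}F|, |w|, |∂_{p_b}w| ≤ C e^{θH}`, `θ < 1/(2T)`):
`∫ F (-∂_{p_b} w + (p_b/T) w) ρ = ∫ (∂_{p_b} F) w ρ`. [folklore] -/
theorem integral_mul_adjointP (hω : 0 < ω₂) (hl : 0 ≤ lam) (hβ : 0 ≤ β) (γ : ℝ) (N : ℕ)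
    {T θ : ℝ} (hT : 0 < T) (hθ : θ < 1 / (2 * T)) (b : Fin N) {F w : PhaseSpace N → ℝ}
    (hF : ContDiff ℝ 1 F) (hw : ContDiff ℝ 1 w) {CF Cw : ℝ}
    (hFle : ∀ x, |F x| ≤ CF * Real.exp (θ * (pinnedChain ω₂ lam β γ).hamiltonian N x))
    (hFp : ∀ x, |partialP b F x| ≤ CF * Real.exp (θ * (pinnedChain ω₂ lam β γ).hamiltonian N x))
    (hwle : ∀ x, |w x| ≤ Cw * Real.exp (θ * (pinnedChain ω₂ lam β γ).hamiltonian N x))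
    (hwp : ∀ x, |partialP b w x| ≤ Cw * Real.exp (θ * (pinnedChain ω₂ lam β γ).hamiltonian N x)) :
    ∫ x, F x * (-partialP b w x + x.2 b / T * w x) * (pinnedChain ω₂ lam β γ).gibbsDensity N T x =
      ∫ x, partialP b F x * w x * (pinnedChain ω₂ lam β γ).gibbsDensity N T x := by
  have h2θ : 2 * θ < 1 / T := by
    have h := (lt_div_iff₀ (by positivity : (0:ℝ) < 2 * T)).mp hθ
    rw [lt_div_iff₀ hT]; linarith
  have hFd : Differentiable ℝ F := hF.differentiable one_ne_zero
  have hwd : Differentiable ℝ w := hw.differentiable one_ne_zero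
  have hpi : ∀ x : PhaseSpace N, |x.2 b| ≤ 1 * (1 + (pinnedChain ω₂ lam β γ).hamiltonian N x) ^ 1 :=
    fun x => abs_momentum_le_one_add hl hβ γ N x b hω.le
  have hibp := integral_mul_lineDeriv_mul_gibbsDensity hω hl hβ γ N hT hθ
    (v := ((0, Pi.single b 1) : PhaseSpace N)) (D := fun x => x.2 b)
    (fun x => (pinnedChain ω₂ lam β γ).hasLineDerivAt_hamiltonian_unitP N x b) (by fun_prop) hpi
    (a := F) (a' := partialP b F) (g := w) (g' := partialP b w) hF.continuous
    (continuous_partialP hF one_ne_zero b) hw.continuous (continuous_partialP hw one_ne_zero b)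
    (fun x => hasLineDerivAt_partialP hFd b x) (fun x => hasLineDerivAt_partialP hwd b x)
    (A := CF) (C := Cw) (m := 0) (fun x => by simpa using hFle x) (fun x => by simpa using hFp x)
    hwle hwp
  have I1 : Integrable fun x => F x * partialP b w x * (pinnedChain ω₂ lam β γ).gibbsDensity N T x :=
    integrable_mul_gibbsDensity_of_le_exp hω hl hβ γ N hT h2θ 0
      (hF.continuous.mul (continuous_partialP hw one_ne_zero b)) fun x =>
        abs_mul_le_of_le_exp (m := 0) (A := CF) (by simpa using hFle x) (hwp x)
  have I2 : Integrable fun x => x.2 b * F x * w x * (pinnedChain ω₂ lam β γ).gibbsDensity N T x :=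
    integrable_mul_gibbsDensity_of_le_exp hω hl hβ γ N hT h2θ (1 + 0)
      (((by fun_prop : Continuous fun x : PhaseSpace N => x.2 b).mul hF.continuous).mul
        hw.continuous) fun x =>
        abs_mul_mul_le_of_le_exp (hpi x) (A := CF) (by simpa using hFle x) (hwle x)
  have hsplit : ∫ x, F x * (-partialP b w x + x.2 b / T * w x) *
      (pinnedChain ω₂ lam β γ).gibbsDensity N T x =
      T⁻¹ * (∫ x, x.2 b * F x * w x * (pinnedChain ω₂ lam β γ).gibbsDensity N T x) -
        ∫ x, F x * partialP b w x * (pinnedChain ω₂ lam β γ).gibbsDensity N T x := by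
    rw [← integral_const_mul, ← integral_sub (I2.const_mul _) I1]
    refine integral_congr_ae (Filter.Eventually.of_forall fun x => ?_)
    simp only
    ring
  rw [hsplit, hibp]
  ring

/-! ### Expanding squares in `L²(ρ)` -/

/-- `∫ (t a - v)² ρ = (∫ a² ρ) t² - 2 (∫ a v ρ) t + ∫ v² ρ` for continuous class members
`a, v = O(e^{θH})`, `θ < 1/(2T)` (all three products are integrable). [folklore] -/
theorem integral_sq_sub_eq (hω : 0 < ω₂) (hl : 0 ≤ lam) (hβ : 0 ≤ β) (γ : ℝ) (N : ℕ)
    {T θ : ℝ} (hT : 0 < T) (hθ : θ < 1 / (2 * T)) {a v : PhaseSpace N → ℝ} (ha : Continuous a)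
    (hv : Continuous v) {Ca Cv : ℝ}
    (hale : ∀ x, |a x| ≤ Ca * Real.exp (θ * (pinnedChain ω₂ lam β γ).hamiltonian N x))
    (hvle : ∀ x, |v x| ≤ Cv * Real.exp (θ * (pinnedChain ω₂ lam β γ).hamiltonian N x)) (t : ℝ) :
    ∫ x, (t * a x - v x) ^ 2 * (pinnedChain ω₂ lam β γ).gibbsDensity N T x =
      (∫ x, a x * a x * (pinnedChain ω₂ lam β γ).gibbsDensity N T x) * t ^ 2 -
        2 * (∫ x, a x * v x * (pinnedChain ω₂ lam β γ).gibbsDensity N T x) * t +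
        ∫ x, v x ^ 2 * (pinnedChain ω₂ lam β γ).gibbsDensity N T x := by
  have h2θ : 2 * θ < 1 / T := by
    have h := (lt_div_iff₀ (by positivity : (0:ℝ) < 2 * T)).mp hθ
    rw [lt_div_iff₀ hT]; linarith
  have Iaa : Integrable fun x => a x * a x * (pinnedChain ω₂ lam β γ).gibbsDensity N T x :=
    integrable_mul_gibbsDensity_of_le_exp hω hl hβ γ N hT h2θ 0 (ha.mul ha) fun x =>
      abs_mul_le_of_le_exp (m := 0) (A := Ca) (by simpa using hale x) (hale x)
  have Iav : Integrable fun x => a x * v x * (pinnedChain ω₂ lam β γ).gibbsDensity N T x :=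
    integrable_mul_gibbsDensity_of_le_exp hω hl hβ γ N hT h2θ 0 (ha.mul hv) fun x =>
      abs_mul_le_of_le_exp (m := 0) (A := Ca) (by simpa using hale x) (hvle x)
  have Ivv : Integrable fun x => v x ^ 2 * (pinnedChain ω₂ lam β γ).gibbsDensity N T x := by
    refine (integrable_mul_gibbsDensity_of_le_exp hω hl hβ γ N hT h2θ 0 (hv.mul hv) fun x =>
      abs_mul_le_of_le_exp (m := 0) (A := Cv) (by simpa using hvle x) (hvle x)).congr
      (Filter.Eventually.of_forall fun x => ?_)
    simp only [Pi.mul_apply]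
    ring
  have hsplit : (fun x => (t * a x - v x) ^ 2 * (pinnedChain ω₂ lam β γ).gibbsDensity N T x) =
      fun x => (t ^ 2 * (a x * a x * (pinnedChain ω₂ lam β γ).gibbsDensity N T x) -
        2 * t * (a x * v x * (pinnedChain ω₂ lam β γ).gibbsDensity N T x)) +
        v x ^ 2 * (pinnedChain ω₂ lam β γ).gibbsDensity N T x := by
    funext x; ring
  have I1 : Integrable fun x => t ^ 2 * (a x * a x * (pinnedChain ω₂ lam β γ).gibbsDensity N T x) :=
    Iaa.const_mul _
  have I2 : Integrable fun x => 2 * t * (a x * v x * (pinnedChain ω₂ lam β γ).gibbsDensity N T x) :=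
    Iav.const_mul _
  have I12 : Integrable fun x => t ^ 2 * (a x * a x * (pinnedChain ω₂ lam β γ).gibbsDensity N T x) -
      2 * t * (a x * v x * (pinnedChain ω₂ lam β γ).gibbsDensity N T x) := I1.sub I2
  rw [hsplit, integral_add I12 Ivv, integral_sub I1 I2, integral_const_mul, integral_const_mul]
  ring

/-- `0 ≤ ∫ (t a - v)² ρ` (no integrability needed). [folklore] -/
theorem integral_sq_sub_nonneg (ω₂ lam β γ : ℝ) (N : ℕ) (T : ℝ) (a v : PhaseSpace N → ℝ) (t : ℝ) :
    0 ≤ ∫ x, (t * a x - v x) ^ 2 * (pinnedChain ω₂ lam β γ).gibbsDensity N T x :=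
  integral_nonneg fun x => mul_nonneg (sq_nonneg _)
    ((pinnedChain ω₂ lam β γ).gibbsDensity_pos N T x).le

/-- `∑_i (X_i t² - 2 Y_i t + Z_i) = (∑ X) t² - 2 (∑ Y) t + ∑ Z`. [folklore] -/
theorem sum_quadratic_eq {ι : Type*} (s : Finset ι) (X Y Z : ι → ℝ) (t : ℝ) :
    ∑ i ∈ s, (X i * (t * t) + (-2 * Y i) * t + Z i) =
      (∑ i ∈ s, X i) * (t * t) + (-2 * ∑ i ∈ s, Y i) * t + ∑ i ∈ s, Z i := by
  simp only [Finset.sum_add_distrib, Finset.sum_mul, Finset.mul_sum]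

/-- `B² ≤ A C` whenever `A t² - 2 B t + C ≥ 0` for all real `t` (discriminant). [folklore] -/
theorem sq_le_mul_of_forall_quadratic_nonneg {A B C : ℝ}
    (h : ∀ t : ℝ, 0 ≤ A * (t * t) + (-2 * B) * t + C) : B ^ 2 ≤ A * C := by
  have hd := discrim_le_zero h
  rw [discrim] at hd
  nlinarith [hd]

/-- **Cauchy–Schwarz for the two-bath form** (discriminant of `t ↦ ∑_b ∫ (t a_b - v_b)² ρ ≥ 0`):
`(∑_b ∫ a_b v_b ρ)² ≤ (∑_b ∫ a_b² ρ)(∑_b ∫ v_b² ρ)`, the bath sum being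
`∑_i ([i = 0] X_i^L + [i = N-1] X_i^R)`. [folklore] -/
theorem bathSum_cauchySchwarz (hω : 0 < ω₂) (hl : 0 ≤ lam) (hβ : 0 ≤ β) (γ : ℝ) (N : ℕ)
    {T θ : ℝ} (hT : 0 < T) (hθ : θ < 1 / (2 * T)) {a vL vR : Fin N → PhaseSpace N → ℝ}
    (ha : ∀ i, Continuous (a i)) (hvL : ∀ i, Continuous (vL i)) (hvR : ∀ i, Continuous (vR i))
    {C : ℝ} (hale : ∀ i x, |a i x| ≤ C * Real.exp (θ * (pinnedChain ω₂ lam β γ).hamiltonian N x))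
    (hvLle : ∀ i x, |vL i x| ≤ C * Real.exp (θ * (pinnedChain ω₂ lam β γ).hamiltonian N x))
    (hvRle : ∀ i x, |vR i x| ≤ C * Real.exp (θ * (pinnedChain ω₂ lam β γ).hamiltonian N x)) :
    (∑ i : Fin N, ((if i.val = 0 then ∫ x, a i x * vL i x *
        (pinnedChain ω₂ lam β γ).gibbsDensity N T x else 0) +
      (if i.val = N - 1 then ∫ x, a i x * vR i x *
        (pinnedChain ω₂ lam β γ).gibbsDensity N T x else 0))) ^ 2 ≤
    (∑ i : Fin N, ((if i.val = 0 then ∫ x, a i x * a i x *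
        (pinnedChain ω₂ lam β γ).gibbsDensity N T x else 0) +
      (if i.val = N - 1 then ∫ x, a i x * a i x *
        (pinnedChain ω₂ lam β γ).gibbsDensity N T x else 0))) *
    (∑ i : Fin N, ((if i.val = 0 then ∫ x, vL i x ^ 2 *
        (pinnedChain ω₂ lam β γ).gibbsDensity N T x else 0) +
      (if i.val = N - 1 then ∫ x, vR i x ^ 2 *
        (pinnedChain ω₂ lam β γ).gibbsDensity N T x else 0))) := by
  refine sq_le_mul_of_forall_quadratic_nonneg fun t => ?_
  have hq : ∀ i : Fin N, (if i.val = 0 then ∫ x, (t * a i x - vL i x) ^ 2 *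
      (pinnedChain ω₂ lam β γ).gibbsDensity N T x else 0) +
      (if i.val = N - 1 then ∫ x, (t * a i x - vR i x) ^ 2 *
        (pinnedChain ω₂ lam β γ).gibbsDensity N T x else 0) =
      ((if i.val = 0 then ∫ x, a i x * a i x * (pinnedChain ω₂ lam β γ).gibbsDensity N T x
        else 0) + (if i.val = N - 1 then ∫ x, a i x * a i x *
          (pinnedChain ω₂ lam β γ).gibbsDensity N T x else 0)) * (t * t) +
      (-2 * ((if i.val = 0 then ∫ x, a i x * vL i x * (pinnedChain ω₂ lam β γ).gibbsDensity N T x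
        else 0) + (if i.val = N - 1 then ∫ x, a i x * vR i x *
          (pinnedChain ω₂ lam β γ).gibbsDensity N T x else 0))) * t +
      ((if i.val = 0 then ∫ x, vL i x ^ 2 * (pinnedChain ω₂ lam β γ).gibbsDensity N T x else 0) +
        (if i.val = N - 1 then ∫ x, vR i x ^ 2 * (pinnedChain ω₂ lam β γ).gibbsDensity N T x
          else 0)) := by
    intro i
    rw [integral_sq_sub_eq hω hl hβ γ N hT hθ (ha i) (hvL i) (hale i) (hvLle i) t,
      integral_sq_sub_eq hω hl hβ γ N hT hθ (ha i) (hvR i) (hale i) (hvRle i) t]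
    split_ifs <;> ring
  have hpos : 0 ≤ ∑ i : Fin N, ((if i.val = 0 then ∫ x, (t * a i x - vL i x) ^ 2 *
      (pinnedChain ω₂ lam β γ).gibbsDensity N T x else 0) +
      (if i.val = N - 1 then ∫ x, (t * a i x - vR i x) ^ 2 *
        (pinnedChain ω₂ lam β γ).gibbsDensity N T x else 0)) := by
    refine Finset.sum_nonneg fun i _ => add_nonneg ?_ ?_
    · split_ifs
      · exact integral_sq_sub_nonneg ω₂ lam β γ N T (a i) (vL i) t
      · exact le_rfl
    · split_ifs
      · exact integral_sq_sub_nonneg ω₂ lam β γ N T (a i) (vR i) t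
      · exact le_rfl
  calc (0 : ℝ) ≤ _ := hpos
    _ = _ := Finset.sum_congr rfl fun i _ => hq i
    _ = _ := sum_quadratic_eq _ _ _ _ t

/-- **The dissipation identity.** Under `L_{T,T} F = -J` (unnormalised):
`∫ J F ρ = γ T ∑_b ∫ (∂_{p_b}F)² ρ` (antisymmetry kills `∫ F (A F) ρ`). [folklore] -/
theorem integral_current_mul_self (hω : 0 < ω₂) (hl : 0 ≤ lam) (hβ : 0 ≤ β) {γ : ℝ}
    (hγ : 0 < γ) (N : ℕ) {T θ : ℝ} (hT : 0 < T) (hθ : θ < 1 / (2 * T))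
    {F : PhaseSpace N → ℝ} (hF : ContDiff ℝ 2 F) {C : ℝ}
    (hFle : ∀ x, |F x| ≤ C * Real.exp (θ * (pinnedChain ω₂ lam β γ).hamiltonian N x))
    (hFq : ∀ x i, |partialQ i F x| ≤ C * Real.exp (θ * (pinnedChain ω₂ lam β γ).hamiltonian N x))
    (hFp : ∀ x i, |partialP i F x| ≤ C * Real.exp (θ * (pinnedChain ω₂ lam β γ).hamiltonian N x))
    (hLF : ∀ x, (pinnedChain ω₂ lam β γ).generator N T T F x =
      -(∑ i, (pinnedChain ω₂ lam β γ).bondCurrent N i x)) :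
    ∫ x, (∑ i, (pinnedChain ω₂ lam β γ).bondCurrent N i x) * F x *
        (pinnedChain ω₂ lam β γ).gibbsDensity N T x =
      γ * T * ∑ i : Fin N,
        ((if i.val = 0 then ∫ x, partialP i F x * partialP i F x *
            (pinnedChain ω₂ lam β γ).gibbsDensity N T x else 0) +
          (if i.val = N - 1 then ∫ x, partialP i F x * partialP i F x *
            (pinnedChain ω₂ lam β γ).gibbsDensity N T x else 0)) := by
  have hF1 : ContDiff ℝ 1 F := hF.of_le one_le_two
  have h1 := integral_current_mul_eq hω hl hβ hγ N hT hθ hF hF1 hFle hFq hFp hFle hFq hFp hLF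
  have hB := integral_liouville_mul_eq_neg hω hl hβ γ N hT hθ hF1 hF1 hFle hFq hFp hFle hFq hFp
  have hcomm : ∫ x, (∑ i, (x.2 i * partialQ i F x -
      partialQ i ((pinnedChain ω₂ lam β γ).hamiltonian N) x * partialP i F x)) * F x *
      (pinnedChain ω₂ lam β γ).gibbsDensity N T x =
      ∫ x, F x * (∑ i, (x.2 i * partialQ i F x -
        partialQ i ((pinnedChain ω₂ lam β γ).hamiltonian N) x * partialP i F x)) *
        (pinnedChain ω₂ lam β γ).gibbsDensity N T x :=
    integral_congr_ae (Filter.Eventually.of_forall fun x => by simp only; ring)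
  rw [hcomm] at hB
  have h0 : ∫ x, F x * (∑ i, (x.2 i * partialQ i F x -
      partialQ i ((pinnedChain ω₂ lam β γ).hamiltonian N) x * partialP i F x)) *
      (pinnedChain ω₂ lam β γ).gibbsDensity N T x = 0 := by linarith
  rw [h1, h0, zero_add]

end Pinned

/-- Twelve nonnegative reals whose sum is `≤ M` are each `≤ M`. [folklore] -/
theorem le_of_sum_twelve_le {a₁ a₂ a₃ a₄ a₅ a₆ a₇ a₈ a₉ a₁₀ a₁₁ a₁₂ M : ℝ}
    (h₁ : 0 ≤ a₁) (h₂ : 0 ≤ a₂) (h₃ : 0 ≤ a₃) (h₄ : 0 ≤ a₄) (h₅ : 0 ≤ a₅) (h₆ : 0 ≤ a₆)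
    (h₇ : 0 ≤ a₇) (h₈ : 0 ≤ a₈) (h₉ : 0 ≤ a₉) (h₁₀ : 0 ≤ a₁₀) (h₁₁ : 0 ≤ a₁₁) (h₁₂ : 0 ≤ a₁₂)
    (h : a₁ + a₂ + a₃ + a₄ + a₅ + a₆ + a₇ + a₈ + a₉ + a₁₀ + a₁₁ + a₁₂ ≤ M) :
    a₁ ≤ M ∧ a₂ ≤ M ∧ a₃ ≤ M ∧ a₄ ≤ M ∧ a₅ ≤ M ∧ a₆ ≤ M ∧ a₇ ≤ M ∧ a₈ ≤ M ∧ a₉ ≤ M ∧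
      a₁₀ ≤ M ∧ a₁₁ ≤ M ∧ a₁₂ ≤ M := by
  refine ⟨?_, ?_, ?_, ?_, ?_, ?_, ?_, ?_, ?_, ?_, ?_, ?_⟩ <;> linarith

end Summit.AtomisticToContinuum.FouriersLaw.Theorems.ThomsonBound

end
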